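import Literature.MathematicalPhysics.StatisticalMechanics.Theil2006SimplexExpansion
import Literature.MathematicalPhysics.StatisticalMechanics.Theil2006RenormalizedPotential
import HarnessLib

/-!
# Theil 2006, §2.4 (31) and (33): Lemma 2.10 applied to an admissible potential; the estimate
`|e_*(p) - e(p)| ≤ C α` on short-range pairs; the `O(α)` tail series of (41)

Topic: `Literature/MathematicalPhysics/StatisticalMechanics`; companion to `Theil2006.lean`
(F. Theil, *A proof of crystallization in two dimensions*, Comm. Math. Phys. **262** (2006)
209–236; read in the author's accepted preprint of 26 Aug 2005, identical numbering, p. 10) and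
to `Theil2006SimplexExpansion.lean` (Lemma 2.10 (30)). Everything here is PROVED; no named fact
is added or discharged. The two displayed estimates (31) and (33) of §2.4 ("Resummation") are the
two applications of Lemma 2.10 to the pair potential `f = V` of Theorem 1.1: (31) bounds the
energy of one long-range equilateral simplex `T ∈ 𝒯_λ(y)`, `λ ∈ Λ ∖ {1}`, from BELOW by the
rigid-simplex energy `3V(λ)` plus the area defect, (33) bounds the rescaled energy of one
short-range simplex `S ∈ 𝒯₁(y)` from ABOVE by the same main term; in both the error is the
quadratic distortion of the simplex with a coefficient `C α λ⁻⁷`, resp. `C α λ⁻⁵`, supplied by the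
decay hypothesis (5) `|V''(r)| ≤ α r⁻⁷` and its consequence `|V'(r)| ≤ α r⁻⁶/6`
(`Theil2006Decay.lean`). These are the per-simplex inputs of (32), (34), (36), (37) and finally of
the main local estimate (9) behind the lower bound of Theorem 1.1 (`Theil2006_groundStateEnergy`).

## The printed text (preprint p. 10, verbatim)

> We extract the leading energy contribution of the long-range interactions. By Lemma 2.10
> and decay estimate (5) we obtain for every `λ ∈ Λ ∖ {1}` and `T ∈ 𝒯_λ(y)`
> (31) `Σ_{p ⊂ T, #p = 2} e(p) ≥ 3V(λ) + (2√3/λ) V'(λ) (meas(conv(y(T))) - (√3/4) λ²)`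
> `- C α λ⁻⁷ Σ_{{x,x'} ⊂ T} (|y(x) - y(x')| - λ)²`.
> […]
> Another application of Lemma 2.10 transforms the main term in (32) back into a pair sum
> (33) `3V(λ) + (2√3/λ) V'(λ) (meas(conv(λ y(S))) - (√3/4) λ²)`
> `≥ Σ_{{x,x'} ⊂ S} V(λ |y(x) - y(x')|) - C α λ⁻⁵ Σ_{{x,x'} ⊂ S} (|y(x) - y(x')| - 1)²`,
> where `S ∈ 𝒯₁(y)` is arbitary.

Here (p. 4, Notation) `e({x,x'}) = V(|y(x) - y(x')|)`, "`{x,x'} ⊂ X_N` mean[s] sets with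
precisely 2 elements", and "the letter `C` denotes a generic positive constant which does not
depend on `α` or `#X_N = N` as long as `α ∈ [0, ⅓]`"; (p. 8) `Λ = {λ > 0 | m(λ) ≠ 0}` "is the set of
distances" of `A₂`, (21) `m(λ) = ⅙ #(A₂ ∩ {|η| = λ})`, so `Λ ∖ {1} = {|ξ| : ξ ∈ A₂, |ξ| ≥ √3}`;
`T ∈ 𝒯_λ(y)` (Definition 2.6) is a three-element `T ⊂ X`, for `λ = 1` with all its pairs in
`𝒮 = {{x,x'} : ||y(x) - y(x')| - 1| ≤ α}`, for `λ > 1` defect-free around `T` and carried by a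
discrete imbedding `Φ_T` with `|Φ(x) - Φ(x')| = λ` on `T` ((23), (24)), whence Lemma 2.7 (25):
`|(1/λ)|y(x) - y(x')| - 1| ≤ K α` for all `{x,x'} ⊂ T`.

## Content and rendering

* `Theil2006.IsAdmissible.le_simplexEnergy` — **(31) for one simplex**: for `V` satisfying
  (2)–(5) with parameter `α` (`IsAdmissible α V`), `λ ≥ √3` and three points `p q r ∈ ℝ²` whose
  mutual distances satisfy `|(1/λ)|· - ·| - 1| ≤ 1/5`,
  `3V(λ) + (2√3/λ) V'(λ) (area(p,q,r) - (√3/4)λ²) - 210 α λ⁻⁷ Σ_{pairs} (|· - ·| - λ)²`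
  `≤ V(|p - q|) + V(|p - r|) + V(|q - r|)`.
  This is exactly the printed derivation: Lemma 2.10 (`simplex_expansion_bound`, constant `40`,
  for `f = V ∈ C²(1-α, ∞)`) with `(1/λ)|V'(λ)| ≤ (α/6) λ⁻⁷` (`IsAdmissible.abs_deriv_le`, one
  integration of (5)) and `‖V''‖_{L^∞((4/5)λ,(6/5)λ)} ≤ 5 α λ⁻⁷` ((5) itself, since
  `(4/5)λ ≥ (4/5)√3 > 4/3`; `IsAdmissible.abs_deriv2_le_of_lt`); `40 · (1/6 + 5) ≤ 210`.
* `Theil2006.IsAdmissible.le_simplexEnergy_of_le` — **(31) in the printed setting**: a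
  configuration `y : X → ℝ²`, three labels `x₁ x₂ x₃`, `meas(conv(y(T)))` the Lebesgue measure of
  the convex hull of their images (`volume_convexHull_triple_toReal`), the hypothesis in the form
  (25) `|(1/λ)|y(x) - y(x')| - 1| ≤ K α` with `K α ≤ 1/5`, and `λ ≥ √3`;
  `Theil2006.IsAdmissible.le_simplexEnergy_of_norm_triPoint` takes `λ = |ξ|`, `ξ ∈ A₂`, `|ξ| ≠ 0, 1`
  literally (`λ ∈ Λ ∖ {1}`; `sqrt_three_le_norm_triPoint_of_ne_one`);
  `Theil2006.exists_longRange_simplex_bound` is the constants form ("a generic positive constant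
  `C`", for all `K`, all `α ∈ (0, α₀(K))`).
* `Theil2006.IsAdmissible.scaledSimplexEnergy_le` — **(33) for one simplex**: for `λ ≥ √3` and
  `p q r` with `||· - ·| - 1| ≤ 1/5`,
  `V(λ|p - q|) + V(λ|p - r|) + V(λ|q - r|) - 210 α λ⁻⁵ Σ_{pairs} (|· - ·| - 1)²`
  `≤ 3V(λ) + (2√3/λ) V'(λ) (area(λp, λq, λr) - (√3/4)λ²)` — Lemma 2.10 for the dilated triangle
  `λY` (side lengths `λ|yᵢ - yⱼ|`, so `Σ (|λyᵢ - λyⱼ| - λ)² = λ² Σ (|yᵢ - yⱼ| - 1)²` turns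
  `λ⁻⁷` into `λ⁻⁵`); `Theil2006.IsAdmissible.scaledSimplexEnergy_le_of_le` is the printed
  setting (`S ∈ 𝒯₁(y)`: the three pairs are short-range bonds, `||y(x) - y(x')| - 1| ≤ α`,
  `α ≤ 1/5`; `meas(conv(λ y(S)))` literal), `Theil2006.exists_shortRange_simplex_bound` the
  constants form; `Theil2006.triangleArea_smul` records `meas(conv(λY)) = λ² meas(conv(Y))`, by
  which the right-hand side is the main term `3V(λ) + 2√3 λ V'(λ) (meas(conv(y(S))) - √3/4)` of
  (32) (`Theil2006.IsAdmissible.scaledSimplexEnergy_le'`).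

* `Theil2006.IsAdmissible.abs_renormalizedPotential_sub_le` — **the short-range comparison of
  p. 11**: "Inequality (12) gives for each `p ∈ 𝒮(y)` the estimates
  `|e_*(p) - e(p)| ≤ ⅙ Σ_{ξ ∈ A₂, |ξ| > 1} α ((1-α)|ξ|)⁻⁵ ≤ C α`" (`e_*({x,x'}) = V_*(|y(x) - y(x')|)`,
  `V_*` = `Theil2006.renormalizedPotential`): for `α ≤ 1/5` and `|r - 1| ≤ α`,
  `|V_*(r) - V(r)| ≤ ⅙ Σ_{|ξ| > 1} α ((1-α)|ξ|)⁻⁵` with the middle sum indexed literally by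
  `{k : |triPoint k| > 1}`; `Theil2006.exists_abs_renormalizedPotential_sub_le` is the `≤ C α` form
  (`C = ⅙ (5/4)⁵ Σ_{|ξ| > 1} |ξ|⁻⁵`), and `Theil2006.exists_sum_abs_sub_renormalizedPotential_le` the
  summed form of (38) for an arbitrary finite set `P ⊆ 𝒮(y)` of short-range pairs,
  `Σ_{p ∈ P} |e(p) - e_*(p)| ≤ C α #P` (the printed (38) takes `P = 𝒮₀ ∪ 𝒮₁` together with the
  count `#(𝒮₀ ∪ 𝒮₁) ≤ C #∂X`, which needs the simplices `𝒯₁(y)` and is not formalized here).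

* `Theil2006.IsAdmissible.summable_longRange_shells`, `…longRange_bracket_le` — **the analytic
  half of (41)**: `Σ_{d=2}^∞ (d + ⅓)³ ‖V‖_{L^∞((d+⅓,∞))} ≤ α` (so with (40) `n(d) = C d³ #∂X` the
  bracket `n(4/3) α + Σ_{d=2}^∞ n(d+⅓) ‖V‖_{L^∞((⅓+d,∞))}` is `≤ C ((4/3)³ + 1) α #∂X`), from (12)
  `‖V‖_{L^∞((s,∞))} ≤ α s⁻⁵` (`IsAdmissible.sSup_abs_Ioi_le`) and `Σ_d 1/((d+1)(d+2)) = 1`.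

What is NOT formalized here: Definition 2.6 itself (discrete imbeddings, Definition 2.4, (23),
(24)) and Lemma 2.7 (its conclusion (25) is taken as the hypothesis, which is all (31) uses of
`T ∈ 𝒯_λ(y)`), Proposition 2.9 and (32), (34)–(37), the count `#(𝒮₀ ∪ 𝒮₁) ≤ C #∂X` of (38),
(39), the count (40) and the pair partition `ℒ₀ ∪ ℒ₁` of (41). Constants: the paper's `C`, `α₀`, `K` are unspecified; ours (`C = 210`, tolerance
`K α ≤ 1/5`, i.e. `α₀ = 1/(5K)`, resp. `α ≤ 1/5`) are explicit but immaterial — any tolerance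
below `1 - 4/(3√3) ≈ 0.23` keeps the Taylor window `((1-Kα)λ, (1+Kα)λ)` inside the decay region
`r > 4/3` of (5) for every `λ ≥ √3`, and keeps `(1-α)|ξ| ≥ (1-α)√3 > 4/3` for `|ξ| > 1`, where (12)
applies.
-/

noncomputable section

open scoped BigOperators Topology ENNReal
open Filter Set MeasureTheory

namespace Literature.MathematicalPhysics.StatisticalMechanics

namespace Theil2006

variable {α : ℝ} {V : ℝ → ℝ}

/-! ## The decay hypothesis (5) on the Taylor window of a long-range simplex -/

/-- `5/3 < √3` (so `λ ≥ √3` gives `λ > 5/3 > 4/3` and `(4/5)λ > 4/3`). [folklore] -/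
private theorem five_thirds_lt_sqrt_three : (5 : ℝ) / 3 < √3 :=
  (Real.lt_sqrt (by norm_num)).2 (by norm_num)

/-- **Decay estimate (5) on the window of Lemma 2.10.** For `V` satisfying (5)
`|V''(r)| ≤ α r⁻⁷` (`r > 4/3`), `λ ≥ √3` and `t > (4/5)λ` (`> 4/3`):
`|V''(t)| ≤ α t⁻⁷ ≤ (5/4)⁷ α λ⁻⁷ ≤ 5 α λ⁻⁷`. This is the bound
`‖V''‖_{L^∞((1-Kα)λ,(1+Kα)λ)} ≤ C α λ⁻⁷` used in (31) ("By Lemma 2.10 and decay estimate (5)").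
[cite: Theil2006, §2.4 (31) (preprint p. 10)] -/
theorem IsAdmissible.abs_deriv2_le_of_lt (hV : IsAdmissible α V) {lam t : ℝ} (hlam : √3 ≤ lam)
    (ht : 4 / 5 * lam < t) : |deriv^[2] V t| ≤ 5 * α * lam⁻¹ ^ 7 := by
  have hα := hV.alpha_nonneg
  have h53 := five_thirds_lt_sqrt_three
  have hlam0 : 0 < lam := by linarith
  have h45 : 0 < 4 / 5 * lam := by positivity
  have h43 : 4 / 3 < t := by linarith
  have h1 : t⁻¹ ≤ 5 / 4 * lam⁻¹ := by
    rw [show 5 / 4 * lam⁻¹ = (4 / 5 * lam)⁻¹ by rw [mul_inv, inv_div]]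
    exact inv_anti₀ h45 ht.le
  have h7 : 0 ≤ lam⁻¹ ^ 7 := pow_nonneg (inv_nonneg.2 hlam0.le) 7
  calc |deriv^[2] V t| ≤ α * t⁻¹ ^ 7 := hV.decay t h43
    _ ≤ α * (5 / 4 * lam⁻¹) ^ 7 := by gcongr
    _ = (5 / 4 : ℝ) ^ 7 * (α * lam⁻¹ ^ 7) := by ring
    _ ≤ 5 * (α * lam⁻¹ ^ 7) := mul_le_mul_of_nonneg_right (by norm_num) (mul_nonneg hα h7)
    _ = 5 * α * lam⁻¹ ^ 7 := by ring

/-- **`(1/λ)|V'(λ)| ≤ (α/6) λ⁻⁷` for `λ ≥ √3`**: the first summand of the factor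
`(1/λ)|f'(λ)| + ‖f''‖_∞` of (30) for `f = V`, from `|V'(r)| ≤ α r⁻⁶/6` (`r ≥ 4/3`, one
integration of (5), `IsAdmissible.abs_deriv_le`). [cite: Theil2006, §2.4 (31) (preprint p. 10)] -/
theorem IsAdmissible.abs_deriv_div_le (hV : IsAdmissible α V) {lam : ℝ} (hlam : √3 ≤ lam) :
    |deriv V lam| / lam ≤ α / 6 * lam⁻¹ ^ 7 := by
  have h53 := five_thirds_lt_sqrt_three
  have hlam0 : 0 < lam := by linarith
  have h := hV.abs_deriv_le (r := lam) (by linarith)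
  calc |deriv V lam| / lam = |deriv V lam| * lam⁻¹ := div_eq_mul_inv _ _
    _ ≤ α / 6 * lam⁻¹ ^ 6 * lam⁻¹ := mul_le_mul_of_nonneg_right h (inv_nonneg.2 hlam0.le)
    _ = α / 6 * lam⁻¹ ^ 7 := by ring

/-- The coefficient of (31)/(33): `40 ((1/λ)|V'(λ)| + 5 α λ⁻⁷) ≤ 210 α λ⁻⁷` for `λ ≥ √3`
(`40 (1/6 + 5) = 206⅔`). [cite: Theil2006, §2.4 (31) (preprint p. 10)] -/
private theorem IsAdmissible.coeff_le (hV : IsAdmissible α V) {lam : ℝ} (hlam : √3 ≤ lam) :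
    40 * (|deriv V lam| / lam + 5 * α * lam⁻¹ ^ 7) ≤ 210 * α * lam⁻¹ ^ 7 := by
  have hα := hV.alpha_nonneg
  have h53 := five_thirds_lt_sqrt_three
  have hlam0 : 0 < lam := by linarith
  have h7 : 0 ≤ lam⁻¹ ^ 7 := pow_nonneg (inv_nonneg.2 hlam0.le) 7
  have hd := hV.abs_deriv_div_le hlam
  nlinarith [mul_nonneg hα h7]

/-! ## (31): the energy of one long-range simplex from below -/

/-- **Theil 2006, (31), for one simplex.** Let `V` satisfy the hypotheses (1)–(5) of Theorem 1.1
with parameter `α` (only `V ∈ C²(1-α, ∞)` and (5) are used), let `λ ≥ √3` (every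
`λ ∈ Λ ∖ {1}`, `Λ` the distance set of `A₂`, is `≥ √3`) and let `p, q, r ∈ ℝ²` have mutual
distances with `|(1/λ)|· - ·| - 1| ≤ 1/5` (the conclusion (25) of Lemma 2.7 for `T ∈ 𝒯_λ(y)`,
`y(T) = {p, q, r}`, once `K α ≤ 1/5`). Then
`Σ_{pairs} V(|· - ·|) ≥ 3V(λ) + (2√3/λ) V'(λ) (meas(conv{p,q,r}) - (√3/4) λ²)`
`- 210 α λ⁻⁷ Σ_{pairs} (|· - ·| - λ)²`
(`meas(conv{p,q,r}) = triangleArea p q r`, `volume_convexHull_triple_toReal`). Proof as printed: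
"By Lemma 2.10 and decay estimate (5)" — `simplex_expansion_bound` with `f = V`,
`M = 5 α λ⁻⁷` (`abs_deriv2_le_of_lt`) and `(1/λ)|V'(λ)| ≤ (α/6) λ⁻⁷` (`abs_deriv_div_le`).
[cite: Theil2006, §2.4 (31) (preprint p. 10)] -/
theorem IsAdmissible.le_simplexEnergy (hV : IsAdmissible α V) {lam : ℝ} (hlam : √3 ≤ lam)
    {p q r : Plane} (hpq : |dist p q / lam - 1| ≤ 1 / 5) (hpr : |dist p r / lam - 1| ≤ 1 / 5)
    (hqr : |dist q r / lam - 1| ≤ 1 / 5) :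
    3 * V lam + 2 * √3 / lam * deriv V lam * (triangleArea p q r - √3 / 4 * lam ^ 2)
        - 210 * α * lam⁻¹ ^ 7
          * ((dist p q - lam) ^ 2 + (dist p r - lam) ^ 2 + (dist q r - lam) ^ 2)
      ≤ V (dist p q) + V (dist p r) + V (dist q r) := by
  have hα := hV.alpha_nonneg
  have h53 := five_thirds_lt_sqrt_three
  have hlam0 : 0 < lam := by linarith
  have ha : 1 - α < (1 - 1 / 5) * lam := by nlinarith
  have hM : ∀ t ∈ Ioo ((1 - 1 / 5) * lam) ((1 + 1 / 5) * lam), |deriv^[2] V t|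
      ≤ 5 * α * lam⁻¹ ^ 7 := fun t ht => hV.abs_deriv2_le_of_lt hlam (by linarith [ht.1])
  have key := simplex_expansion_bound (f := V) (by norm_num : (0 : ℝ) < 1 / 5) (by norm_num)
    hlam0 hV.contDiffOn ha hpq hpr hqr hM
  have hS : 0 ≤ (dist p q - lam) ^ 2 + (dist p r - lam) ^ 2 + (dist q r - lam) ^ 2 := by
    positivity
  linarith [(abs_le.1 key).2, mul_le_mul_of_nonneg_right (hV.coeff_le hlam) hS]

/-- Outside `0` and the six unit vectors every point of `A₂` has norm `≥ √3`; in the notation of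
(21), `Λ ∖ {1} ⊂ [√3, ∞)` for the distance set `Λ = {|ξ| : ξ ∈ A₂ ∖ {0}}`.
[cite: Theil2006, §2.3 (21) (preprint p. 8)] -/
theorem sqrt_three_le_norm_triPoint_of_ne_one {k : ℤ × ℤ} (hk0 : k ≠ 0) (hk1 : ‖triPoint k‖ ≠ 1) :
    √3 ≤ ‖triPoint k‖ :=
  sqrt_three_le_norm_triPoint hk0 fun hk => hk1 (norm_triPoint_of_mem_unitShell hk)

/-- **Theil 2006, (31), in the printed setting.** For a configuration `y : X → ℝ²`, a potential
`V` satisfying (1)–(5) with parameter `α`, `λ ≥ √3` and three labels `x₁ x₂ x₃` (the simplex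
`T = {x₁, x₂, x₃}`) whose images satisfy (25) `|(1/λ)|y(x) - y(x')| - 1| ≤ K α` with `K α ≤ 1/5`:
`Σ_{p ⊂ T, #p = 2} e(p) ≥ 3V(λ) + (2√3/λ) V'(λ) (meas(conv(y(T))) - (√3/4) λ²)`
`- C α λ⁻⁷ Σ_{{x,x'} ⊂ T} (|y(x) - y(x')| - λ)²` with `C = 210`, where
`e({x,x'}) = V(|y(x) - y(x')|)` and `meas(conv(y(T)))` is the Lebesgue measure of the convex hull
of `{y x₁, y x₂, y x₃}` in `ℝ² = EuclideanSpace ℝ (Fin 2)`. (Definition 2.6 of `𝒯_λ(y)` and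
Lemma 2.7, which supplies (25) for `T ∈ 𝒯_λ(y)`, are not formalized; (25) is the hypothesis.)
[cite: Theil2006, §2.4 (31) (preprint p. 10)] -/
theorem IsAdmissible.le_simplexEnergy_of_le {X : Type*} (hV : IsAdmissible α V) (y : X → Plane)
    {lam K : ℝ} (hlam : √3 ≤ lam) (hK : K * α ≤ 1 / 5) {x₁ x₂ x₃ : X}
    (h₁₂ : |dist (y x₁) (y x₂) / lam - 1| ≤ K * α) (h₁₃ : |dist (y x₁) (y x₃) / lam - 1| ≤ K * α)
    (h₂₃ : |dist (y x₂) (y x₃) / lam - 1| ≤ K * α) :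
    3 * V lam + 2 * √3 / lam * deriv V lam *
          ((volume (convexHull ℝ ({y x₁, y x₂, y x₃} : Set Plane))).toReal - √3 / 4 * lam ^ 2)
        - 210 * α * lam⁻¹ ^ 7 * ((dist (y x₁) (y x₂) - lam) ^ 2
            + (dist (y x₁) (y x₃) - lam) ^ 2 + (dist (y x₂) (y x₃) - lam) ^ 2)
      ≤ V (dist (y x₁) (y x₂)) + V (dist (y x₁) (y x₃)) + V (dist (y x₂) (y x₃)) := by
  rw [volume_convexHull_triple_toReal]
  exact hV.le_simplexEnergy hlam (h₁₂.trans hK) (h₁₃.trans hK) (h₂₃.trans hK)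

/-- **Theil 2006, (31)** with `λ ∈ Λ ∖ {1}` literal: `λ = |ξ|` for a lattice vector
`ξ = triPoint k ∈ A₂` with `|ξ| ≠ 0, 1` (then `|ξ| ≥ √3`). Same statement and constants as
`le_simplexEnergy_of_le`. [cite: Theil2006, §2.4 (31) (preprint p. 10)] -/
theorem IsAdmissible.le_simplexEnergy_of_norm_triPoint {X : Type*} (hV : IsAdmissible α V)
    (y : X → Plane) {k : ℤ × ℤ} (hk0 : k ≠ 0) (hk1 : ‖triPoint k‖ ≠ 1) {K : ℝ}
    (hK : K * α ≤ 1 / 5) {x₁ x₂ x₃ : X}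
    (h₁₂ : |dist (y x₁) (y x₂) / ‖triPoint k‖ - 1| ≤ K * α)
    (h₁₃ : |dist (y x₁) (y x₃) / ‖triPoint k‖ - 1| ≤ K * α)
    (h₂₃ : |dist (y x₂) (y x₃) / ‖triPoint k‖ - 1| ≤ K * α) :
    3 * V ‖triPoint k‖ + 2 * √3 / ‖triPoint k‖ * deriv V ‖triPoint k‖ *
          ((volume (convexHull ℝ ({y x₁, y x₂, y x₃} : Set Plane))).toReal
            - √3 / 4 * ‖triPoint k‖ ^ 2)
        - 210 * α * ‖triPoint k‖⁻¹ ^ 7 * ((dist (y x₁) (y x₂) - ‖triPoint k‖) ^ 2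
            + (dist (y x₁) (y x₃) - ‖triPoint k‖) ^ 2 + (dist (y x₂) (y x₃) - ‖triPoint k‖) ^ 2)
      ≤ V (dist (y x₁) (y x₂)) + V (dist (y x₁) (y x₃)) + V (dist (y x₂) (y x₃)) :=
  hV.le_simplexEnergy_of_le y (sqrt_three_le_norm_triPoint_of_ne_one hk0 hk1) hK h₁₂ h₁₃ h₂₃

/-- **Theil 2006, (31), constants form** ("`C` denotes a generic positive constant which does not
depend on `α` or `N`"): there is `C > 0` such that for every `K > 0` there is `α₀ > 0` with: for all
`α ∈ (0, α₀)`, all `V` satisfying (1)–(5) with parameter `α`, all `λ ≥ √3` and all triangles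
`p q r` satisfying (25) with the constant `K`,
`Σ_{pairs} V(|· - ·|) ≥ 3V(λ) + (2√3/λ) V'(λ) (meas(conv{p,q,r}) - (√3/4)λ²) - C α λ⁻⁷ Σ_{pairs} (|· - ·| - λ)²`.
Witnesses `C = 210`, `α₀ = 1/(5K)`. [cite: Theil2006, §2.4 (31) (preprint p. 10)] -/
theorem exists_longRange_simplex_bound :
    ∃ C : ℝ, 0 < C ∧ ∀ K : ℝ, 0 < K → ∃ α₀ : ℝ, 0 < α₀ ∧ ∀ ⦃α : ℝ⦄, α ∈ Ioo 0 α₀ →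
      ∀ ⦃V : ℝ → ℝ⦄, IsAdmissible α V → ∀ ⦃lam : ℝ⦄, √3 ≤ lam → ∀ p q r : Plane,
      |dist p q / lam - 1| ≤ K * α → |dist p r / lam - 1| ≤ K * α →
      |dist q r / lam - 1| ≤ K * α →
        3 * V lam + 2 * √3 / lam * deriv V lam *
              ((volume (convexHull ℝ ({p, q, r} : Set Plane))).toReal - √3 / 4 * lam ^ 2)
            - C * α * lam⁻¹ ^ 7
              * ((dist p q - lam) ^ 2 + (dist p r - lam) ^ 2 + (dist q r - lam) ^ 2)
          ≤ V (dist p q) + V (dist p r) + V (dist q r) := by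
  refine ⟨210, by norm_num, fun K hK => ⟨1 / (5 * K), by positivity, ?_⟩⟩
  intro α hα V hV lam hlam p q r hpq hpr hqr
  have hKα : K * α ≤ 1 / 5 := by
    have h := hα.2
    rw [lt_div_iff₀ (by positivity)] at h
    linarith [mul_comm K α]
  rw [volume_convexHull_triple_toReal]
  exact hV.le_simplexEnergy hlam (hpq.trans hKα) (hpr.trans hKα) (hqr.trans hKα)

/-! ## (33): the rescaled energy of one short-range simplex from above -/

/-- Dilation scales areas quadratically: `meas(conv(λY)) = λ² meas(conv(Y))` for a triangle —
the identity by which the main term of (32), `3V(λ) + 2√3 λ V'(λ) (meas(conv(y(S))) - √3/4)`,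
is the left-hand side `3V(λ) + (2√3/λ) V'(λ) (meas(conv(λ y(S))) - (√3/4) λ²)` of (33).
[cite: Theil2006, §2.4 (32)–(33) (preprint p. 10)] -/
theorem triangleArea_smul (c : ℝ) (p q r : Plane) :
    triangleArea (c • p) (c • q) (c • r) = c ^ 2 * triangleArea p q r := by
  simp only [triangleArea, det₂, ← smul_sub, PiLp.smul_apply, smul_eq_mul]
  rw [show c * (q - p) 0 * (c * (r - p) 1) - c * (q - p) 1 * (c * (r - p) 0) =
      c ^ 2 * ((q - p) 0 * (r - p) 1 - (q - p) 1 * (r - p) 0) by ring, abs_mul, abs_pow, sq_abs]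
  ring

/-- Dilation scales distances: `|λp - λq| = λ|p - q|` for `λ ≥ 0`. [folklore] -/
private theorem dist_smul_of_nonneg {c : ℝ} (hc : 0 ≤ c) (p q : Plane) :
    dist (c • p) (c • q) = c * dist p q := by
  rw [dist_smul₀, Real.norm_eq_abs, abs_of_nonneg hc]

/-- **Theil 2006, (33), for one simplex.** Let `V` satisfy (1)–(5) with parameter `α`, let
`λ ≥ √3` and let `p, q, r ∈ ℝ²` have mutual distances with `||· - ·| - 1| ≤ 1/5` (a short-range
simplex `S ∈ 𝒯₁(y)`, `y(S) = {p, q, r}`, once `α ≤ 1/5`). Then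
`Σ_{pairs} V(λ|· - ·|) - 210 α λ⁻⁵ Σ_{pairs} (|· - ·| - 1)²`
`≤ 3V(λ) + (2√3/λ) V'(λ) (meas(conv{λp, λq, λr}) - (√3/4) λ²)`.
Proof as printed ("Another application of Lemma 2.10"): `simplex_expansion_bound` for the dilated
triangle `λp, λq, λr` (side lengths `λ|· - ·|`, within `λ/5` of `λ`) with `f = V`,
`M = 5 α λ⁻⁷`, `(1/λ)|V'(λ)| ≤ (α/6) λ⁻⁷`, and `Σ (λ|· - ·| - λ)² = λ² Σ (|· - ·| - 1)²`.
[cite: Theil2006, §2.4 (33) (preprint p. 10)] -/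
theorem IsAdmissible.scaledSimplexEnergy_le (hV : IsAdmissible α V) {lam : ℝ} (hlam : √3 ≤ lam)
    {p q r : Plane} (hpq : |dist p q - 1| ≤ 1 / 5) (hpr : |dist p r - 1| ≤ 1 / 5)
    (hqr : |dist q r - 1| ≤ 1 / 5) :
    V (lam * dist p q) + V (lam * dist p r) + V (lam * dist q r)
        - 210 * α * lam⁻¹ ^ 5 * ((dist p q - 1) ^ 2 + (dist p r - 1) ^ 2 + (dist q r - 1) ^ 2)
      ≤ 3 * V lam + 2 * √3 / lam * deriv V lam
          * (triangleArea (lam • p) (lam • q) (lam • r) - √3 / 4 * lam ^ 2) := by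
  have hα := hV.alpha_nonneg
  have h53 := five_thirds_lt_sqrt_three
  have hlam0 : 0 < lam := by linarith
  have hd : ∀ a b : Plane, dist (lam • a) (lam • b) = lam * dist a b :=
    dist_smul_of_nonneg hlam0.le
  have htol : ∀ {a b : Plane}, |dist a b - 1| ≤ 1 / 5 →
      |dist (lam • a) (lam • b) / lam - 1| ≤ 1 / 5 := fun h => by
    rwa [hd, mul_div_cancel_left₀ _ hlam0.ne']
  have ha : 1 - α < (1 - 1 / 5) * lam := by nlinarith
  have hM : ∀ t ∈ Ioo ((1 - 1 / 5) * lam) ((1 + 1 / 5) * lam), |deriv^[2] V t|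
      ≤ 5 * α * lam⁻¹ ^ 7 := fun t ht => hV.abs_deriv2_le_of_lt hlam (by linarith [ht.1])
  have key := simplex_expansion_bound (f := V) (by norm_num : (0 : ℝ) < 1 / 5) (by norm_num)
    hlam0 hV.contDiffOn ha (htol hpq) (htol hpr) (htol hqr) hM
  rw [hd, hd, hd] at key
  have hsq : (lam * dist p q - lam) ^ 2 + (lam * dist p r - lam) ^ 2 + (lam * dist q r - lam) ^ 2
      = lam ^ 2 * ((dist p q - 1) ^ 2 + (dist p r - 1) ^ 2 + (dist q r - 1) ^ 2) := by ring
  rw [hsq] at key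
  have hS : 0 ≤ (dist p q - 1) ^ 2 + (dist p r - 1) ^ 2 + (dist q r - 1) ^ 2 := by positivity
  have hcoef : 40 * (|deriv V lam| / lam + 5 * α * lam⁻¹ ^ 7) * lam ^ 2 ≤ 210 * α * lam⁻¹ ^ 5 := by
    have h75 : lam⁻¹ ^ 7 * lam ^ 2 = lam⁻¹ ^ 5 := by field_simp
    calc 40 * (|deriv V lam| / lam + 5 * α * lam⁻¹ ^ 7) * lam ^ 2
        ≤ 210 * α * lam⁻¹ ^ 7 * lam ^ 2 :=
          mul_le_mul_of_nonneg_right (hV.coeff_le hlam) (sq_nonneg _)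
      _ = 210 * α * lam⁻¹ ^ 5 := by rw [mul_assoc, h75]
  have := mul_le_mul_of_nonneg_right hcoef hS
  nlinarith [(abs_le.1 key).1, this]

/-- **Theil 2006, (33), with the main term of (32).** Same as `scaledSimplexEnergy_le`, the
right-hand side written as in (32): `3V(λ) + 2√3 λ V'(λ) (meas(conv{p,q,r}) - √3/4)`
(`meas(conv(λY)) = λ² meas(conv(Y))`, `triangleArea_smul`).
[cite: Theil2006, §2.4 (32)–(33) (preprint p. 10)] -/
theorem IsAdmissible.scaledSimplexEnergy_le' (hV : IsAdmissible α V) {lam : ℝ} (hlam : √3 ≤ lam)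
    {p q r : Plane} (hpq : |dist p q - 1| ≤ 1 / 5) (hpr : |dist p r - 1| ≤ 1 / 5)
    (hqr : |dist q r - 1| ≤ 1 / 5) :
    V (lam * dist p q) + V (lam * dist p r) + V (lam * dist q r)
        - 210 * α * lam⁻¹ ^ 5 * ((dist p q - 1) ^ 2 + (dist p r - 1) ^ 2 + (dist q r - 1) ^ 2)
      ≤ 3 * V lam + 2 * √3 * lam * deriv V lam * (triangleArea p q r - √3 / 4) := by
  have h53 := five_thirds_lt_sqrt_three
  have hlam0 : 0 < lam := by linarith
  have h := hV.scaledSimplexEnergy_le hlam hpq hpr hqr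
  rw [triangleArea_smul] at h
  have e : 2 * √3 / lam * deriv V lam * (lam ^ 2 * triangleArea p q r - √3 / 4 * lam ^ 2) =
      2 * √3 * lam * deriv V lam * (triangleArea p q r - √3 / 4) := by
    field_simp
  linarith [h, e]

/-- **Theil 2006, (33), in the printed setting.** For a configuration `y : X → ℝ²`, a potential
`V` satisfying (1)–(5) with parameter `α ≤ 1/5`, `λ ≥ √3` and a short-range simplex
`S = {x₁, x₂, x₃} ∈ 𝒯₁(y)` (its three pairs lie in `𝒮`: `||y(x) - y(x')| - 1| ≤ α`):
`3V(λ) + (2√3/λ) V'(λ) (meas(conv(λ y(S))) - (√3/4) λ²)`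
`≥ Σ_{{x,x'} ⊂ S} V(λ|y(x) - y(x')|) - C α λ⁻⁵ Σ_{{x,x'} ⊂ S} (|y(x) - y(x')| - 1)²`
with `C = 210`, `meas(conv(λ y(S)))` the Lebesgue measure of the convex hull of
`{λ y x₁, λ y x₂, λ y x₃}`. [cite: Theil2006, §2.4 (33) (preprint p. 10)] -/
theorem IsAdmissible.scaledSimplexEnergy_le_of_le {X : Type*} (hV : IsAdmissible α V)
    (hα5 : α ≤ 1 / 5) (y : X → Plane) {lam : ℝ} (hlam : √3 ≤ lam) {x₁ x₂ x₃ : X}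
    (h₁₂ : |dist (y x₁) (y x₂) - 1| ≤ α) (h₁₃ : |dist (y x₁) (y x₃) - 1| ≤ α)
    (h₂₃ : |dist (y x₂) (y x₃) - 1| ≤ α) :
    V (lam * dist (y x₁) (y x₂)) + V (lam * dist (y x₁) (y x₃)) + V (lam * dist (y x₂) (y x₃))
        - 210 * α * lam⁻¹ ^ 5 * ((dist (y x₁) (y x₂) - 1) ^ 2 + (dist (y x₁) (y x₃) - 1) ^ 2
            + (dist (y x₂) (y x₃) - 1) ^ 2)
      ≤ 3 * V lam + 2 * √3 / lam * deriv V lam *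
          ((volume (convexHull ℝ ({lam • y x₁, lam • y x₂, lam • y x₃} : Set Plane))).toReal
            - √3 / 4 * lam ^ 2) := by
  rw [volume_convexHull_triple_toReal]
  exact hV.scaledSimplexEnergy_le hlam (h₁₂.trans hα5) (h₁₃.trans hα5) (h₂₃.trans hα5)

/-- **Theil 2006, (33), constants form**: there are `C, α₀ > 0` such that for all `α ∈ (0, α₀)`,
all `V` satisfying (1)–(5) with parameter `α`, all `λ ≥ √3` and all triangles `p q r` whose three
pairs are short-range bonds (`||· - ·| - 1| ≤ α`),
`Σ_{pairs} V(λ|· - ·|) - C α λ⁻⁵ Σ_{pairs} (|· - ·| - 1)² ≤ 3V(λ) + (2√3/λ) V'(λ) (meas(conv{λp,λq,λr}) - (√3/4)λ²)`.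
Witnesses `C = 210`, `α₀ = 1/5`. [cite: Theil2006, §2.4 (33) (preprint p. 10)] -/
theorem exists_shortRange_simplex_bound :
    ∃ C α₀ : ℝ, 0 < C ∧ 0 < α₀ ∧ ∀ ⦃α : ℝ⦄, α ∈ Ioo 0 α₀ →
      ∀ ⦃V : ℝ → ℝ⦄, IsAdmissible α V → ∀ ⦃lam : ℝ⦄, √3 ≤ lam → ∀ p q r : Plane,
      |dist p q - 1| ≤ α → |dist p r - 1| ≤ α → |dist q r - 1| ≤ α →
        V (lam * dist p q) + V (lam * dist p r) + V (lam * dist q r)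
            - C * α * lam⁻¹ ^ 5 * ((dist p q - 1) ^ 2 + (dist p r - 1) ^ 2 + (dist q r - 1) ^ 2)
          ≤ 3 * V lam + 2 * √3 / lam * deriv V lam *
              ((volume (convexHull ℝ ({lam • p, lam • q, lam • r} : Set Plane))).toReal
                - √3 / 4 * lam ^ 2) := by
  refine ⟨210, 1 / 5, by norm_num, by norm_num, ?_⟩
  intro α hα V hV lam hlam p q r hpq hpr hqr
  rw [volume_convexHull_triple_toReal]
  exact hV.scaledSimplexEnergy_le hlam (hpq.trans hα.2.le) (hpr.trans hα.2.le)
    (hqr.trans hα.2.le)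

/-! ## The renormalized versus the bare energy of a short-range bond (p. 11) -/

/-- The points of `A₂` of norm `> 1` are exactly those other than `0` and the six unit vectors
(the second shell has radius `√3`). [folklore] -/
private theorem one_lt_norm_triPoint_iff {k : ℤ × ℤ} : 1 < ‖triPoint k‖ ↔ k ≠ 0 ∧ k ∉ unitShell := by
  constructor
  · intro h
    refine ⟨fun h0 => ?_, fun hu => ?_⟩
    · rw [h0, map_zero, norm_zero] at h
      exact absurd h (by norm_num)
    · rw [norm_triPoint_of_mem_unitShell hu] at h
      exact lt_irrefl _ h
  · rintro ⟨h0, hu⟩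
    have h3 : (1 : ℝ) < √3 := (Real.lt_sqrt zero_le_one).2 (by norm_num)
    exact h3.trans_le (sqrt_three_le_norm_triPoint h0 hu)

/-- Re-indexing: a sum over the complement of the unit shell of a function vanishing at the origin
is the sum over `{ξ ∈ A₂ : |ξ| > 1}`. [folklore] -/
private theorem tsum_compl_unitShell_eq (g : ℤ × ℤ → ℝ) (hg : g 0 = 0) :
    ∑' k : ↥((unitShell : Set (ℤ × ℤ))ᶜ), g k = ∑' k : {k : ℤ × ℤ // 1 < ‖triPoint k‖}, g k := by
  rw [tsum_subtype ((unitShell : Set (ℤ × ℤ))ᶜ) g,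
    show (∑' k : {k : ℤ × ℤ // 1 < ‖triPoint k‖}, g k) =
      ∑' k : ↥({k : ℤ × ℤ | 1 < ‖triPoint k‖}), g k from rfl,
    tsum_subtype {k : ℤ × ℤ | 1 < ‖triPoint k‖} g]
  refine tsum_congr fun k => ?_
  by_cases hT : 1 < ‖triPoint k‖
  · have hU : k ∈ (unitShell : Set (ℤ × ℤ))ᶜ := fun hu => (one_lt_norm_triPoint_iff.1 hT).2 hu
    rw [indicator_of_mem hU, indicator_of_mem (show k ∈ {k : ℤ × ℤ | 1 < ‖triPoint k‖} from hT)]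
  · rw [indicator_of_notMem (show k ∉ {k : ℤ × ℤ | 1 < ‖triPoint k‖} from hT)]
    by_cases hU : k ∈ (unitShell : Set (ℤ × ℤ))ᶜ
    · rw [indicator_of_mem hU]
      by_contra hne
      have hk0 : k ≠ 0 := fun h0 => hne (by rw [h0, hg])
      exact hT (one_lt_norm_triPoint_iff.2 ⟨hk0, hU⟩)
    · rw [indicator_of_notMem hU]

/-- **Theil 2006, p. 11: the renormalized and the bare energy of a short-range bond differ by
`O(α)`.** "Inequality (12) gives for each `p ∈ 𝒮(y)` the estimates
`|e_*(p) - e(p)| ≤ ⅙ Σ_{ξ ∈ A₂, |ξ| > 1} α ((1-α)|ξ|)⁻⁵ ≤ C α`", where `e(p) = V(|y(x) - y(x')|)`,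
`e_*(p) = V_*(|y(x) - y(x')|)`, `V_*(r) = ⅙ Σ_{ξ ∈ A₂∖{0}} V(r|ξ|)` and `p = {x,x'} ∈ 𝒮(y)` means
`||y(x) - y(x')| - 1| ≤ α`. Statement for the bond length `r = |y(x) - y(x')|`: if `α ≤ 1/5` and
`|r - 1| ≤ α` then `|V_*(r) - V(r)| ≤ ⅙ Σ_{ξ ∈ A₂, |ξ| > 1} α ((1-α)|ξ|)⁻⁵`, the sum indexed by
the labels `k` with `|triPoint k| > 1`. Proof as printed: `V_*(r) - V(r) = ⅙ Σ_{|ξ| > 1} V(r|ξ|)`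
(the six unit vectors carry `V(r)` each, `IsNormalized.renormalizedPotential_eq_add_tail`), and by
(12) (`IsAdmissible.abs_apply_le'`, applicable since `r|ξ| ≥ (1-α)√3 > 4/3`)
`|V(r|ξ|)| ≤ α (r|ξ|)⁻⁵ ≤ α ((1-α)|ξ|)⁻⁵`. (The threshold `1/5` is ours; the paper's `α₀` is
unspecified.) [cite: Theil2006, §2.4 (37)–(38) (preprint p. 11)] -/
theorem IsAdmissible.abs_renormalizedPotential_sub_le (hV : IsAdmissible α V) (hα5 : α ≤ 1 / 5)
    {r : ℝ} (hr : |r - 1| ≤ α) :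
    |renormalizedPotential V r - V r|
      ≤ 1 / 6 * ∑' k : {k : ℤ × ℤ // 1 < ‖triPoint k‖}, α * ((1 - α) * ‖triPoint k.1‖)⁻¹ ^ 5 := by
  have hα0 := hV.alpha_nonneg
  obtain ⟨hr1, hr2⟩ := abs_le.1 hr
  have hr0 : 0 < r := by linarith
  have h53 := five_thirds_lt_sqrt_three
  rw [hV.toIsNormalized.renormalizedPotential_eq_add_tail hr0, add_sub_cancel_left]
  set W : ℝ → ℝ := fun s => V (r * s) with hW
  set U : Set (ℤ × ℤ) := (unitShell : Set (ℤ × ℤ))ᶜ with hU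
  set b : ℤ × ℤ → ℝ := fun k => α * ((1 - α) * ‖triPoint k‖)⁻¹ ^ 5 with hb
  have hsU : Summable fun k : U => latticePotential W k :=
    (hV.hasSum_latticePotential_dilate hr0).summable.subtype U
  have hb_summ : Summable b := by
    refine (summable_norm_triPoint_inv_pow.mul_left (α * (1 - α)⁻¹ ^ 5)).congr fun k => ?_
    simp only [hb, mul_inv, mul_pow]
    ring
  have hbU : Summable fun k : U => b k := hb_summ.subtype U
  have hterm : ∀ k : U, |latticePotential W k| ≤ b k := by
    intro k
    by_cases hk0 : (k : ℤ × ℤ) = 0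
    · rw [hk0]
      simp [hb]
    · have hk : (k : ℤ × ℤ) ∉ unitShell := k.2
      have h3 := sqrt_three_le_norm_triPoint hk0 hk
      rw [latticePotential_of_ne _ hk0]
      have hn : 5 / 3 < ‖triPoint (k : ℤ × ℤ)‖ := h53.trans_le h3
      have harg : 4 / 3 ≤ r * ‖triPoint (k : ℤ × ℤ)‖ := by
        have := mul_le_mul (by linarith : 4 / 5 ≤ r) hn.le (by norm_num) hr0.le
        linarith
      refine (hV.abs_apply_le' harg).trans ?_
      have hpos : 0 < (1 - α) * ‖triPoint (k : ℤ × ℤ)‖ := mul_pos (by linarith) (by linarith)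
      have hle : (1 - α) * ‖triPoint (k : ℤ × ℤ)‖ ≤ r * ‖triPoint (k : ℤ × ℤ)‖ :=
        mul_le_mul_of_nonneg_right (by linarith) (norm_nonneg _)
      have hinv : (r * ‖triPoint (k : ℤ × ℤ)‖)⁻¹ ≤ ((1 - α) * ‖triPoint (k : ℤ × ℤ)‖)⁻¹ :=
        inv_anti₀ hpos hle
      have h5 : (r * ‖triPoint (k : ℤ × ℤ)‖)⁻¹ ^ 5 ≤ ((1 - α) * ‖triPoint (k : ℤ × ℤ)‖)⁻¹ ^ 5 :=
        pow_le_pow_left₀ (inv_nonneg.2 (hpos.le.trans hle)) hinv 5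
      exact mul_le_mul_of_nonneg_left h5 hα0
  have key : |∑' k : U, latticePotential W k| ≤ ∑' k : U, b k := by
    have h1 : ‖∑' k : U, latticePotential W k‖ ≤ ∑' k : U, ‖latticePotential W k‖ :=
      norm_tsum_le_tsum_norm hsU.norm
    simp only [Real.norm_eq_abs] at h1
    exact h1.trans (hsU.abs.tsum_le_tsum hterm hbU)
  rw [tsum_compl_unitShell_eq b (by simp [hb])] at key
  rw [abs_div, abs_of_pos (by norm_num : (0 : ℝ) < 6)]
  linarith

/-- `Σ_{ξ ∈ A₂, |ξ| > 1} α ((1-α)|ξ|)⁻⁵ = α (1-α)⁻⁵ Σ_{|ξ| > 1} |ξ|⁻⁵`.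
[cite: Theil2006, §2.4 (37)–(38) (preprint p. 11)] -/
theorem tsum_shortRange_majorant_eq (α : ℝ) :
    ∑' k : {k : ℤ × ℤ // 1 < ‖triPoint k‖}, α * ((1 - α) * ‖triPoint k.1‖)⁻¹ ^ 5
      = α * (1 - α)⁻¹ ^ 5 * ∑' k : {k : ℤ × ℤ // 1 < ‖triPoint k‖}, ‖triPoint k.1‖⁻¹ ^ 5 := by
  rw [← tsum_mul_left]
  exact tsum_congr fun k => by rw [mul_inv, mul_pow]; ring

/-- **Theil 2006, p. 11, "`≤ C α`"**: there is a universal `C ≥ 0` (here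
`C = ⅙ (5/4)⁵ Σ_{ξ ∈ A₂, |ξ| > 1} |ξ|⁻⁵`) with `|e_*(p) - e(p)| = |V_*(r) - V(r)| ≤ C α` for every
`α ≤ 1/5`, every `V` satisfying (1)–(5) with parameter `α` and every short-range bond length `r`,
`|r - 1| ≤ α`. [cite: Theil2006, §2.4 (37)–(38) (preprint p. 11)] -/
theorem exists_abs_renormalizedPotential_sub_le :
    ∃ C : ℝ, 0 ≤ C ∧ ∀ ⦃α : ℝ⦄ ⦃V : ℝ → ℝ⦄, α ≤ 1 / 5 → IsAdmissible α V →
      ∀ ⦃r : ℝ⦄, |r - 1| ≤ α → |renormalizedPotential V r - V r| ≤ C * α := by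
  set S := ∑' k : {k : ℤ × ℤ // 1 < ‖triPoint k‖}, ‖triPoint k.1‖⁻¹ ^ 5 with hS
  have hS0 : 0 ≤ S := tsum_nonneg fun k => pow_nonneg (inv_nonneg.2 (norm_nonneg _)) 5
  refine ⟨1 / 6 * (5 / 4 : ℝ) ^ 5 * S, by positivity, fun α V hα5 hV r hr => ?_⟩
  have hα0 := hV.alpha_nonneg
  have h := hV.abs_renormalizedPotential_sub_le hα5 hr
  rw [tsum_shortRange_majorant_eq] at h
  have h54 : (1 - α)⁻¹ ≤ 5 / 4 := inv_le_of_inv_le₀ (by norm_num) (by norm_num; linarith)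
  have h54' : (1 - α)⁻¹ ^ 5 ≤ (5 / 4 : ℝ) ^ 5 :=
    pow_le_pow_left₀ (inv_nonneg.2 (by linarith)) h54 5
  have hstep : α * (1 - α)⁻¹ ^ 5 * S ≤ α * (5 / 4 : ℝ) ^ 5 * S :=
    mul_le_mul_of_nonneg_right (mul_le_mul_of_nonneg_left h54' hα0) hS0
  calc |renormalizedPotential V r - V r| ≤ 1 / 6 * (α * (1 - α)⁻¹ ^ 5 * S) := h
    _ ≤ 1 / 6 * (α * (5 / 4 : ℝ) ^ 5 * S) := by linarith
    _ = 1 / 6 * (5 / 4 : ℝ) ^ 5 * S * α := by ring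

/-- **Theil 2006, (38), summed over an arbitrary finite set of short-range pairs.** With the
same universal `C`: for every configuration `y : X_N → ℝ²`, every `α ≤ 1/5`, every `V`
satisfying (1)–(5) and every finite set `P ⊆ 𝒮(y)` of short-range pairs
(`Theil2006.shortRangePairs`), `Σ_{p ∈ P} |e(p) - e_*(p)| ≤ C α #P`. The printed (38),
`Σ_{p ∈ 𝒮₀ ∪ 𝒮₁} |e(p) - e_*(p)| ≤ C α #∂X`, is this with `P = 𝒮₀ ∪ 𝒮₁` and the count
`#(𝒮₀ ∪ 𝒮₁) ≤ C #∂X` ("The lower bound on the minimum distance (13) implies that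
`#(𝒮₀(y) + 𝒮₁(y)) ≤ C #∂X`"), whose simplices `𝒯₁(y)` are not formalized here.
[cite: Theil2006, §2.4 (38) (preprint pp. 11–12)] -/
theorem exists_sum_abs_sub_renormalizedPotential_le :
    ∃ C : ℝ, 0 ≤ C ∧ ∀ ⦃α : ℝ⦄ ⦃V : ℝ → ℝ⦄, α ≤ 1 / 5 → IsAdmissible α V →
      ∀ {N : ℕ} (y : Fin N → Plane) (P : Finset (Fin N × Fin N)), P ⊆ shortRangePairs α y →
        ∑ p ∈ P, |V (dist (y p.1) (y p.2)) - renormalizedPotential V (dist (y p.1) (y p.2))|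
          ≤ C * α * P.card := by
  obtain ⟨C, hC, h⟩ := exists_abs_renormalizedPotential_sub_le
  refine ⟨C, hC, fun α V hα5 hV N y P hP => ?_⟩
  have hle : ∀ p ∈ P,
      |V (dist (y p.1) (y p.2)) - renormalizedPotential V (dist (y p.1) (y p.2))| ≤ C * α := by
    intro p hp
    have hp' := (Finset.mem_filter.1 (hP hp)).2.2
    rw [abs_sub_comm]
    exact h hα5 hV hp'
  calc ∑ p ∈ P, |V (dist (y p.1) (y p.2)) - renormalizedPotential V (dist (y p.1) (y p.2))|
      ≤ P.card • (C * α) := Finset.sum_le_card_nsmul _ _ _ hle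
    _ = C * α * P.card := by rw [nsmul_eq_mul]; ring

/-! ## (41): the interactions beyond distance `7/3` cost `O(α)` per defect -/

/-- `|V(r)| ≤ α s⁻⁵` for `r > s ≥ 4/3` ((12) and monotonicity of `s⁻⁵`): the bound
`‖V‖_{L^∞((s,∞))} ≤ α s⁻⁵` used in (41). [cite: Theil2006, §2.4 (41) (preprint p. 12)] -/
theorem IsAdmissible.abs_le_of_lt (hV : IsAdmissible α V) {s r : ℝ} (hs : 4 / 3 ≤ s) (hr : s < r) :
    |V r| ≤ α * s⁻¹ ^ 5 := by
  have hα := hV.alpha_nonneg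
  have hs0 : 0 < s := by linarith
  refine (hV.abs_apply_le' (hs.trans hr.le)).trans ?_
  have h1 : r⁻¹ ≤ s⁻¹ := inv_anti₀ hs0 hr.le
  have h2 : r⁻¹ ^ 5 ≤ s⁻¹ ^ 5 := pow_le_pow_left₀ (inv_nonneg.2 (hs0.le.trans hr.le)) h1 5
  exact mul_le_mul_of_nonneg_left h2 hα

/-- `‖V‖_{L^∞((s,∞))} ≤ α s⁻⁵` for `s ≥ 4/3`, the `L^∞` norm rendered as `sup_{r > s} |V(r)|`.
[cite: Theil2006, §2.4 (41) (preprint p. 12)] -/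
theorem IsAdmissible.sSup_abs_Ioi_le (hV : IsAdmissible α V) {s : ℝ} (hs : 4 / 3 ≤ s) :
    sSup ((fun r => |V r|) '' Ioi s) ≤ α * s⁻¹ ^ 5 :=
  csSup_le ⟨|V (s + 1)|, s + 1, by simp, rfl⟩ (by rintro _ ⟨r, hr, rfl⟩; exact hV.abs_le_of_lt hs hr)

/-- The telescoping sum `Σ_{d<N} 1/((d+1)(d+2)) = 1 - 1/(N+1)`. [folklore] -/
private theorem sum_range_inv_succ_mul_succ (N : ℕ) :
    ∑ d ∈ Finset.range N, (1 : ℝ) / (((d : ℝ) + 1) * ((d : ℝ) + 2)) = 1 - 1 / ((N : ℝ) + 1) := by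
  induction N with
  | zero => simp
  | succ N ih =>
    rw [Finset.sum_range_succ, ih]
    push_cast
    field_simp
    ring

/-- **Theil 2006, (41): the series of long-range shells converges and is `O(α)`.** In (41),
`I₄ + I₅ = Σ_{p ∈ ℒ₀ ∪ ℒ₁} e(p) ≥ -(n(4/3) α + Σ_{d=2}^∞ n(d + ⅓) ‖V‖_{L^∞((⅓+d,∞))}) #∂X ≥ -C α #∂X`
with (40) `n(d) := C d³ #∂X`, the analytic input ("By (4) and (5)", i.e. (12)) is that
`Σ_{d=2}^∞ (d + ⅓)³ ‖V‖_{L^∞((d+⅓,∞))}` converges and is `≤ C α`. Statement (index shifted,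
`d ↦ d + 2`, and `‖V‖_{L^∞((s,∞))} = sup_{r > s} |V(r)|`): for every `V` satisfying (1)–(5) with
parameter `α`, the series `Σ_{d ≥ 0} (d + 2 + ⅓)³ sup_{r > d+2+⅓} |V(r)|` is summable with sum
`≤ α` (each term is `≤ α (d + 7/3)⁻² ≤ α / ((d+1)(d+2))`). The combinatorial count (40) itself
(Proposition 2.8.3 and (13)) is not formalized here. [cite: Theil2006, §2.4 (40)–(41) (preprint p. 12)] -/
theorem IsAdmissible.summable_longRange_shells (hV : IsAdmissible α V) :
    Summable (fun d : ℕ => ((d : ℝ) + 2 + 1 / 3) ^ 3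
        * sSup ((fun r => |V r|) '' Ioi ((d : ℝ) + 2 + 1 / 3))) ∧
      ∑' d : ℕ, ((d : ℝ) + 2 + 1 / 3) ^ 3 * sSup ((fun r => |V r|) '' Ioi ((d : ℝ) + 2 + 1 / 3))
        ≤ α := by
  have hα := hV.alpha_nonneg
  set f : ℕ → ℝ := fun d => ((d : ℝ) + 2 + 1 / 3) ^ 3
    * sSup ((fun r => |V r|) '' Ioi ((d : ℝ) + 2 + 1 / 3)) with hf
  have hf0 : ∀ d, 0 ≤ f d := fun d =>
    mul_nonneg (by positivity) (Real.sSup_nonneg (by rintro _ ⟨r, -, rfl⟩; exact abs_nonneg _))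
  have hfle : ∀ d : ℕ, f d ≤ α * (1 / (((d : ℝ) + 1) * ((d : ℝ) + 2))) := by
    intro d
    have hs : (4 : ℝ) / 3 ≤ (d : ℝ) + 2 + 1 / 3 := by
      have : (0 : ℝ) ≤ d := Nat.cast_nonneg d
      linarith
    have hs0 : (0 : ℝ) < (d : ℝ) + 2 + 1 / 3 := by linarith
    have h1 := hV.sSup_abs_Ioi_le hs
    calc f d ≤ ((d : ℝ) + 2 + 1 / 3) ^ 3 * (α * ((d : ℝ) + 2 + 1 / 3)⁻¹ ^ 5) :=
          mul_le_mul_of_nonneg_left h1 (by positivity)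
      _ = α * (1 / ((d : ℝ) + 2 + 1 / 3) ^ 2) := by field_simp
      _ ≤ α * (1 / (((d : ℝ) + 1) * ((d : ℝ) + 2))) := by
          refine mul_le_mul_of_nonneg_left ?_ hα
          exact one_div_le_one_div_of_le (by positivity) (by nlinarith)
  have hpartial : ∀ N : ℕ, ∑ d ∈ Finset.range N, f d ≤ α := by
    intro N
    calc ∑ d ∈ Finset.range N, f d
        ≤ ∑ d ∈ Finset.range N, α * (1 / (((d : ℝ) + 1) * ((d : ℝ) + 2))) :=
          Finset.sum_le_sum fun d _ => hfle d
      _ = α * (1 - 1 / ((N : ℝ) + 1)) := by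
          rw [← Finset.mul_sum, sum_range_inv_succ_mul_succ]
      _ ≤ α := by
          have : 0 ≤ 1 / ((N : ℝ) + 1) := by positivity
          nlinarith
  exact ⟨summable_of_sum_range_le hf0 hpartial, Real.tsum_le_of_sum_range_le hf0 hpartial⟩

/-- **Theil 2006, (41), the bracket.** With the count function of (40), `n(d) = C d³ B`
(`B = #∂X`, `C ≥ 0`), the bracket of (41) is `O(α) B`:
`n(4/3) α + Σ_{d=2}^∞ n(d + ⅓) ‖V‖_{L^∞((⅓+d,∞))} ≤ C ((4/3)³ + 1) B α`.
[cite: Theil2006, §2.4 (40)–(41) (preprint p. 12)] -/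
theorem IsAdmissible.longRange_bracket_le (hV : IsAdmissible α V) {C B : ℝ} (hC : 0 ≤ C)
    (hB : 0 ≤ B) :
    C * (4 / 3 : ℝ) ^ 3 * B * α
        + ∑' d : ℕ, C * ((d : ℝ) + 2 + 1 / 3) ^ 3 * B
          * sSup ((fun r => |V r|) '' Ioi ((d : ℝ) + 2 + 1 / 3))
      ≤ C * ((4 / 3 : ℝ) ^ 3 + 1) * B * α := by
  obtain ⟨-, hle⟩ := hV.summable_longRange_shells
  have hre : ∀ d : ℕ, C * ((d : ℝ) + 2 + 1 / 3) ^ 3 * B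
      * sSup ((fun r => |V r|) '' Ioi ((d : ℝ) + 2 + 1 / 3))
      = C * B * (((d : ℝ) + 2 + 1 / 3) ^ 3 * sSup ((fun r => |V r|) '' Ioi ((d : ℝ) + 2 + 1 / 3))) :=
    fun d => by ring
  rw [tsum_congr hre, tsum_mul_left]
  have hCB : 0 ≤ C * B := mul_nonneg hC hB
  nlinarith [mul_le_mul_of_nonneg_left hle hCB]

end Theil2006

end Literature.MathematicalPhysics.StatisticalMechanics
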